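import Summits.CriticalPhenomena.PercolationContinuityZ3.Theorems.Transplant.BoxProdZ2Kits
import HarnessLib

/-!
# The `X □ ℤ²` kit lemmas AT A RUNNING PARAMETER `q` (two-parameter forms of `stepIV_inputs_at`, `kit_hIV`, `kitClause`)

builds on p205010 (kernel theorem, internal audit signed; external expert review pending) — nothing in this file uses p205010.
Lane `prim-bschramm`, seat `prim-bschramm-p3` (order I3 of V56: expose the θ-inputs at the RUNNING parameter); helper file
(`--supports stmt-CriticalPhenomena-4575 --as helper`).

Design (D) re-runs the construction at `q₀ < p` (ENTRY-SEED-STAR.md §10–§11): the geometry (fat radius `ψ`, fat prisms, kit cubes, frame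
sequences) stays the one built from `hT : TubeSubcritical X p₀` at `p₀ = p`, while every measure — the standard estimates `hstd`/`hlink`, the
subbox weighting `IsSubbox … Wt q D`, the seed arithmetic `(1 - q^{sB})^k` and the conclusions — is at the running parameter `q`.  The landed
one-parameter lemmas tie both to the same `p`; these are their verbatim two-parameter copies (proofs unchanged: no step uses `q = p₀`).

[cite: KozmaNitzan2024, §4 Lemma 10, Steps III–IV (pp. 19–21) — the ℤ^d model] [cite: GrimmettPercolation1999, §7.2]
-/

noncomputable section

open MeasureTheory

namespace Summit.CriticalPhenomena.PercolationContinuityZ3.Theorems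

namespace Transplant

namespace BoxProdZ2

open Literature.Probability.Percolation Literature.Probability.LatticeModels SimpleGraph KNLevels KozmaNitzan
open Literature.Probability.Percolation.GM
open Literature.Barriers.CriticalPhenomena (graphBall graphBall_finite mem_graphBall_self graphBall_mono mem_graphBall_map)

variable {W : Type} [DecidableEq W] (X : SimpleGraph W) [X.LocallyFinite]

/-- (Two-parameter form: geometry `ψ = ufatRadius X hT V₀` from `hT` at `p₀`, measure at `q`.) **The Step-IV inputs at a candidate contact** (under `P_p` on `X □ ℤ²`): for the scales of `exists_scales` and the kit with fibre radius
`nF = ψ M`, `M ≥ M₀`, at every candidate contact `x` of a wide tube level the frame sequence `Λˣ` satisfies `Λˣ M = kitCube x`,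
`P_p(zone Λˣ (msel τ) M) > 1 - δ` and `P_p(linkIn (kitCube x) (Λˣ (msel τ)) (kitFace x)) > 1 - δ`, where `τ = γ c ∈ V₀`.
[cite: KozmaNitzan2024, §4 pp. 19–21 ((21)–(25))] -/
theorem stepIV_inputs_atQ [Countable W] {p₀ : unitInterval} (hT : TubeSubcritical X p₀) {q : unitInterval} (V₀ : Finset W) {δ : ℝ} {msel : W → ℕ} {M : ℕ}
    (hstd : ∀ τ ∈ V₀,
      1 - δ < (bondPercolation (X □ zdGraph 2) q).real (UniqZone.zone (X □ zdGraph 2) (ufatSeq X hT V₀ τ) (msel τ) M) ∧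
      ∀ g : HOct 2, 1 - δ < (bondPercolation (X □ zdGraph 2) q).real
        (linkIn (↑(ufatSeq X hT V₀ τ M)) (ufatSeq X hT V₀ τ (msel τ)) (ballFin X τ (ufatRadius X hT V₀ M) ×ˢ piece g M)))
    {xe : W} {Rw : ℕ} {lo hi : Site 2} {j : ℕ} (hwide : ∀ k, (lo - ((j : ℕ) : Site 2)) k + 2 * M + 2 ≤ (hi + ((j : ℕ) : Site 2)) k)
    {x : W × Site 2} (hx : x ∈ outerBoundary (tubeGraph X (ballFin X xe Rw)) (tubeLevel (ballFin X xe Rw) lo hi j))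
    (γ : X ≃g X) (hγ : γ (fibCtrT X xe Rw (ufatRadius X hT V₀ M) x.1) ∈ V₀) :
    let v := vctr (lo - ((j : ℕ) : Site 2)) (hi + ((j : ℕ) : Site 2)) M (pwin (lo - ((j : ℕ) : Site 2)) (hi + ((j : ℕ) : Site 2)) M x.2).1
      (pwin (lo - ((j : ℕ) : Site 2)) (hi + ((j : ℕ) : Site 2)) M x.2).2.1 (pwin (lo - ((j : ℕ) : Site 2)) (hi + ((j : ℕ) : Site 2)) M x.2).2.2
    let τ := γ (fibCtrT X xe Rw (ufatRadius X hT V₀ M) x.1)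
    frameSeq X hT V₀ γ v τ M = kitCube X xe Rw (lo - ((j : ℕ) : Site 2)) (hi + ((j : ℕ) : Site 2)) M (ufatRadius X hT V₀ M) x ∧
      1 - δ < (bondPercolation (X □ zdGraph 2) q).real (UniqZone.zone (X □ zdGraph 2) (frameSeq X hT V₀ γ v τ) (msel τ) M) ∧
      1 - δ < (bondPercolation (X □ zdGraph 2) q).real
        (linkIn (↑(kitCube X xe Rw (lo - ((j : ℕ) : Site 2)) (hi + ((j : ℕ) : Site 2)) M (ufatRadius X hT V₀ M) x))
          (frameSeq X hT V₀ γ v τ (msel τ)) (kitFace X xe Rw (lo - ((j : ℕ) : Site 2)) (hi + ((j : ℕ) : Site 2)) M (ufatRadius X hT V₀ M) x)) := by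
  intro v τ
  obtain ⟨-, hW, -⟩ := kit_contact hwide hx
  obtain ⟨hzone, hlink⟩ := hstd τ hγ
  have hcube := frameSeq_eq_kitCube X hT V₀ (xe := xe) (Rw := Rw) (Lo := lo - ((j : ℕ) : Site 2)) (Hi := hi + ((j : ℕ) : Site 2))
    (M := M) (x := x) γ (τ := τ) rfl
  refine ⟨hcube, ?_, ?_⟩
  · -- the uniqueness zone, carried by the frame
    have h := real_zone_image_iso (G := X □ zdGraph 2) (prodFrameIso X γ.symm v) q (ufatSeq X hT V₀ τ) (msel τ) M
    change 1 - δ < (bondPercolation (X □ zdGraph 2) q).real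
      (UniqZone.zone (X □ zdGraph 2) (fun i => (ufatSeq X hT V₀ τ i).image (prodFrameIso X γ.symm v)) (msel τ) M)
    rw [h]; exact hzone
  · -- the linked quarter-piece, carried by the frame, inside the thick face
    obtain ⟨g, hg⟩ := exists_piece_image_subset_kitFace X hT V₀ (xe := xe) (Rw := Rw) (Lo := lo - ((j : ℕ) : Site 2))
      (Hi := hi + ((j : ℕ) : Site 2)) hW γ (τ := τ) rfl
    have h := real_linkIn_image_iso (G := X □ zdGraph 2) (prodFrameIso X γ.symm v) q (ufatSeq X hT V₀ τ M) (ufatSeq X hT V₀ τ (msel τ))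
      (ballFin X τ (ufatRadius X hT V₀ M) ×ˢ piece g M)
    have hmono := linkIn_mono (U := (↑((ufatSeq X hT V₀ τ M).image (prodFrameIso X γ.symm v)) : Set (W × Site 2)))
      (S := (ufatSeq X hT V₀ τ (msel τ)).image (prodFrameIso X γ.symm v)) le_rfl le_rfl hg
    rw [← hcube, frameSeq]
    refine (hlink g).trans_le ?_
    rw [← h]
    exact measureReal_mono hmono (measure_ne_top _ _)

/-- (Two-parameter form: geometry `ψ = ufatRadius X hT V₀` from `hT` at `p₀`, measure at `q`.) **The Step-IV input `hIV` at a candidate contact of the `X □ ℤ²` kit.**  Setting: a subbox weighting `Wt` of the tube graph over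
`π = B_X(xe, Rw)` on `D`; the level-`j` kit with planar scale `M` and fibre radius `nF = ψ M` (`ψ = ufatRadius hT V₀`, `ψ M ≤ Rw`); the
shell `S ⊆ D`; the standard estimates `hstd` of `exists_scales` at `δ²`; a candidate contact `x` with frame `γ` (`γ c ∈ V₀`); and the
target route `h3` from the frame's inner prism `Λˣ (msel τ)` to `Ft ⊆ T` inside `Qt ⊆ D`, `Ft` off the cube.  Conclusion: the `hIV`
clause of `targetLemma_of_kits`. [cite: KozmaNitzan2024, §4 pp. 19–21 ((21)–(25))] -/
theorem kit_hIVQ [Countable W] {p₀ : unitInterval} (hT : TubeSubcritical X p₀) {q : unitInterval} (V₀ : Finset W) {δ : ℝ} (hδ : 0 < δ) {msel : W → ℕ}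
    {M : ℕ} (hmsel : ∀ τ ∈ V₀, msel τ ≤ M)
    (hstd : ∀ τ ∈ V₀,
      1 - δ ^ 2 < (bondPercolation (X □ zdGraph 2) q).real (UniqZone.zone (X □ zdGraph 2) (ufatSeq X hT V₀ τ) (msel τ) M) ∧
      ∀ g : HOct 2, 1 - δ ^ 2 < (bondPercolation (X □ zdGraph 2) q).real
        (linkIn (↑(ufatSeq X hT V₀ τ M)) (ufatSeq X hT V₀ τ (msel τ)) (ballFin X τ (ufatRadius X hT V₀ M) ×ˢ piece g M)))
    {xe : W} {Rw : ℕ} (hnF : ufatRadius X hT V₀ M ≤ Rw) {lo hi : Site 2} {j : ℕ}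
    (hwide : ∀ k, (lo - ((j : ℕ) : Site 2)) k + 2 * M + 2 ≤ (hi + ((j : ℕ) : Site 2)) k)
    {Wt : Sym2 (W × Site 2) → unitInterval} {D T : Finset (W × Site 2)} (hWD : IsSubbox (tubeGraph X (ballFin X xe Rw)) Wt q D)
    (hSD : (ballFin X xe Rw) ×ˢ (Finset.Icc ((lo - ((j : ℕ) : Site 2)) + 1) ((hi + ((j : ℕ) : Site 2)) - 1) \
      Finset.Icc ((lo - ((j : ℕ) : Site 2)) + ((2 * M + 2 : ℕ) : Site 2)) ((hi + ((j : ℕ) : Site 2)) - ((2 * M + 2 : ℕ) : Site 2))) ⊆ D)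
    {x : W × Site 2} (hx : x ∈ outerBoundary (tubeGraph X (ballFin X xe Rw)) (tubeLevel (ballFin X xe Rw) lo hi j))
    (γ : X ≃g X) (hγ : γ (fibCtrT X xe Rw (ufatRadius X hT V₀ M) x.1) ∈ V₀)
    {Qt Ft : Finset (W × Site 2)} (hFt : Ft ⊆ T) (hQt : Qt ⊆ D)
    (hfar : Disjoint Ft (kitCube X xe Rw (lo - ((j : ℕ) : Site 2)) (hi + ((j : ℕ) : Site 2)) M (ufatRadius X hT V₀ M) x))
    (h3 : 1 - δ ^ 2 < (prodBernoulli Wt).real (linkIn (↑Qt)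
      (frameSeq X hT V₀ γ (vctr (lo - ((j : ℕ) : Site 2)) (hi + ((j : ℕ) : Site 2)) M
        (pwin (lo - ((j : ℕ) : Site 2)) (hi + ((j : ℕ) : Site 2)) M x.2).1 (pwin (lo - ((j : ℕ) : Site 2)) (hi + ((j : ℕ) : Site 2)) M x.2).2.1
        (pwin (lo - ((j : ℕ) : Site 2)) (hi + ((j : ℕ) : Site 2)) M x.2).2.2) (γ (fibCtrT X xe Rw (ufatRadius X hT V₀ M) x.1))
        (msel (γ (fibCtrT X xe Rw (ufatRadius X hT V₀ M) x.1)))) Ft)) :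
    1 - 3 * δ ≤ (prodBernoulli Wt).real {ω | ∃ u ∈ kitFace X xe Rw (lo - ((j : ℕ) : Site 2)) (hi + ((j : ℕ) : Site 2)) M (ufatRadius X hT V₀ M) x,
      1 - δ < (prodBernoulli (pinW Wt (wireSet (↑((ballFin X xe Rw) ×ˢ (Finset.Icc ((lo - ((j : ℕ) : Site 2)) + 1) ((hi + ((j : ℕ) : Site 2)) - 1) \
        Finset.Icc ((lo - ((j : ℕ) : Site 2)) + ((2 * M + 2 : ℕ) : Site 2)) ((hi + ((j : ℕ) : Site 2)) - ((2 * M + 2 : ℕ) : Site 2)))) :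
          Set (W × Site 2))) ω)).real (⋃ t ∈ T, openConnIn (↑D : Set (W × Site 2)) u t)} := by
  obtain ⟨hcube, h1p, h2p⟩ := stepIV_inputs_atQ X hT V₀ hstd hwide hx γ hγ
  set v := vctr (lo - ((j : ℕ) : Site 2)) (hi + ((j : ℕ) : Site 2)) M (pwin (lo - ((j : ℕ) : Site 2)) (hi + ((j : ℕ) : Site 2)) M x.2).1
    (pwin (lo - ((j : ℕ) : Site 2)) (hi + ((j : ℕ) : Site 2)) M x.2).2.1 (pwin (lo - ((j : ℕ) : Site 2)) (hi + ((j : ℕ) : Site 2)) M x.2).2.2 with hv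
  set τ := γ (fibCtrT X xe Rw (ufatRadius X hT V₀ M) x.1) with hτ
  set Λ := frameSeq X hT V₀ γ v τ with hΛ
  have hQshell := kitCube_subset_shell (X := X) (xe := xe) (Rw := Rw) (lo := lo) (hi := hi) (j := j) (M := M) hwide hnF hx
  have hQD : kitCube X xe Rw (lo - ((j : ℕ) : Site 2)) (hi + ((j : ℕ) : Site 2)) M (ufatRadius X hT V₀ M) x ⊆ D := hQshell.trans hSD
  have hQπ : ∀ u ∈ kitCube X xe Rw (lo - ((j : ℕ) : Site 2)) (hi + ((j : ℕ) : Site 2)) M (ufatRadius X hT V₀ M) x, u.1 ∈ ballFin X xe Rw :=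
    fun u hu => (Finset.mem_product.1 (hQshell hu)).1
  -- h1 under `prodBernoulli Wt`: subbox + window transfer, then the zone is antitone in the graph
  have h1 : 1 - δ ^ 2 < (prodBernoulli Wt).real (UniqZone.zone (tubeGraph X (ballFin X xe Rw)) Λ (msel τ) M) := by
    rw [real_cubeEvent_eq X hWD hQD hQπ (determinedBy_zone Λ (msel τ) M (by rw [hcube])) (measurableSet_zone Λ (msel τ) M)]
    exact h1p.trans_le (measureReal_mono (zone_anti_graph (tubeGraph_le X (ballFin X xe Rw)) Λ (msel τ) M) (measure_ne_top _ _))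
  -- h2 under `prodBernoulli Wt`
  have h2 : 1 - δ ^ 2 < (prodBernoulli Wt).real (linkIn (↑(Λ M)) (Λ (msel τ))
      (kitFace X xe Rw (lo - ((j : ℕ) : Site 2)) (hi + ((j : ℕ) : Site 2)) M (ufatRadius X hT V₀ M) x)) := by
    rw [hcube, real_cubeEvent_eq X hWD hQD hQπ (determinedBy_linkIn _ _ _ le_rfl) (measurableSet_linkIn _ _ _)]
    exact h2p
  -- Step IV
  have hkn : Λ (msel τ) ⊆ Λ M := frameSeq_mono X hT V₀ γ v τ (hmsel τ hγ)
  have hres := stepIV_in (G := tubeGraph X (ballFin X xe Rw))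
    (S := (ballFin X xe Rw) ×ˢ (Finset.Icc ((lo - ((j : ℕ) : Site 2)) + 1) ((hi + ((j : ℕ) : Site 2)) - 1) \
      Finset.Icc ((lo - ((j : ℕ) : Site 2)) + ((2 * M + 2 : ℕ) : Site 2)) ((hi + ((j : ℕ) : Site 2)) - ((2 * M + 2 : ℕ) : Site 2))))
    hWD hFt hQt Λ hkn (by rw [hcube]; exact hQshell)
    (by rw [hcube]; exact kitFace_subset_innerBoundary_kitCube (X := X) hwide hnF hx) (by rw [hcube]; exact hfar) hδ
    (Rg := (↑D : Set (W × Site 2))) (by rw [hcube]; exact Finset.coe_subset.2 hQD) (Finset.coe_subset.2 hQt) h1 h2 h3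
  exact hres

/-- (Two-parameter form: geometry `ψ = ufatRadius X hT V₀` from `hT` at `p₀`, measure at `q`.) **The kit clause of `TargetProperty` for a tube level of `X □ ℤ²`.**  [cite: KozmaNitzan2024, §4 Lemma 10, Steps III–IV (pp. 19–21)] -/
theorem kitClauseQ [Countable W] {Δ : ℕ} (hΔ : ∀ w, X.degree w ≤ Δ) {p₀ : unitInterval} (hT : TubeSubcritical X p₀) {q : unitInterval} (V₀ : Finset W)
    {δ : ℝ} (hδ : 0 < δ) {msel : W → ℕ} {M : ℕ} (hmsel : ∀ τ ∈ V₀, msel τ ≤ M)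
    (hstd : ∀ τ ∈ V₀,
      1 - δ ^ 2 < (bondPercolation (X □ zdGraph 2) q).real (UniqZone.zone (X □ zdGraph 2) (ufatSeq X hT V₀ τ) (msel τ) M) ∧
      ∀ g : HOct 2, 1 - δ ^ 2 < (bondPercolation (X □ zdGraph 2) q).real
        (linkIn (↑(ufatSeq X hT V₀ τ M)) (ufatSeq X hT V₀ τ (msel τ)) (ballFin X τ (ufatRadius X hT V₀ M) ×ˢ piece g M)))
    {xe : W} {Rw : ℕ} (hnF : ufatRadius X hT V₀ M ≤ Rw) {lo hi : Site 2} {j : ℕ}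
    (hwide : ∀ k, (lo - ((j : ℕ) : Site 2)) k + 2 * M + 2 ≤ (hi + ((j : ℕ) : Site 2)) k) (k : ℕ) (o : W × Site 2)
    (Sfin : Finset (W × Site 2)) {Wt : Sym2 (W × Site 2) → unitInterval} {D T : Finset (W × Site 2)}
    (hWD : IsSubbox (tubeGraph X (ballFin X xe Rw)) Wt q D) (hXD : tubeLevel (ballFin X xe Rw) lo hi j ⊆ D) {N : ℕ}
    (hN : k * kitB Δ M (ufatRadius X hT V₀ M) ≤ N) (hk : (1 - (q : ℝ) ^ kitSB Δ M (ufatRadius X hT V₀ M)) ^ k ≤ δ)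
    (hcon : ∀ x ∈ outerBoundary (tubeGraph X (ballFin X xe Rw)) (tubeLevel (ballFin X xe Rw) lo hi j),
      (∃ u ∈ kitFace X xe Rw (lo - ((j : ℕ) : Site 2)) (hi + ((j : ℕ) : Site 2)) M (ufatRadius X hT V₀ M) x, u ∈ T) ∨
      ∃ (γ : X ≃g X) (Qt Ft : Finset (W × Site 2)), γ (fibCtrT X xe Rw (ufatRadius X hT V₀ M) x.1) ∈ V₀ ∧ Ft ⊆ T ∧ Qt ⊆ D ∧
        Disjoint Ft (kitCube X xe Rw (lo - ((j : ℕ) : Site 2)) (hi + ((j : ℕ) : Site 2)) M (ufatRadius X hT V₀ M) x) ∧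
        1 - δ ^ 2 < (prodBernoulli Wt).real (linkIn (↑Qt)
          (frameSeq X hT V₀ γ (vctr (lo - ((j : ℕ) : Site 2)) (hi + ((j : ℕ) : Site 2)) M
            (pwin (lo - ((j : ℕ) : Site 2)) (hi + ((j : ℕ) : Site 2)) M x.2).1 (pwin (lo - ((j : ℕ) : Site 2)) (hi + ((j : ℕ) : Site 2)) M x.2).2.1
            (pwin (lo - ((j : ℕ) : Site 2)) (hi + ((j : ℕ) : Site 2)) M x.2).2.2) (γ (fibCtrT X xe Rw (ufatRadius X hT V₀ M) x.1))
            (msel (γ (fibCtrT X xe Rw (ufatRadius X hT V₀ M) x.1)))) Ft)) :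
    ∃ (σ : SData (W × Site 2)) (S : Finset (W × Site 2)), SHyp (tubeLData X (ballFin X xe Rw) lo hi o Sfin) j σ ∧ σ.N ≤ N ∧
      (1 - (q : ℝ) ^ σ.sB) ^ σ.k ≤ δ ∧ S ⊆ (tubeLData X (ballFin X xe Rw) lo hi o Sfin).X j ∧ S ⊆ D ∧
      (∀ x ∈ σ.K, ∀ e ∈ σ.seed x, e ∉ wireSet (↑S : Set (W × Site 2))) ∧ (∀ x ∈ σ.K, σ.face x ⊆ S) ∧
      (∀ x ∈ σ.K, 1 - 3 * δ ≤ (prodBernoulli Wt).real {ω | ∃ u ∈ σ.face x,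
        1 - δ < (prodBernoulli (pinW Wt (wireSet (↑S : Set (W × Site 2))) ω)).real (⋃ t ∈ T, openConnIn (↑D : Set (W × Site 2)) u t)}) := by
  set S : Finset (W × Site 2) := (ballFin X xe Rw) ×ˢ (Finset.Icc ((lo - ((j : ℕ) : Site 2)) + 1) ((hi + ((j : ℕ) : Site 2)) - 1) \
    Finset.Icc ((lo - ((j : ℕ) : Site 2)) + ((2 * M + 2 : ℕ) : Site 2)) ((hi + ((j : ℕ) : Site 2)) - ((2 * M + 2 : ℕ) : Site 2))) with hS
  have hSX : S ⊆ tubeLevel (ballFin X xe Rw) lo hi j := shell_subset_tubeLevel _ lo hi j M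
  have hSD : S ⊆ D := hSX.trans hXD
  have hface : ∀ x ∈ outerBoundary (tubeGraph X (ballFin X xe Rw)) (tubeLevel (ballFin X xe Rw) lo hi j),
      kitFace X xe Rw (lo - ((j : ℕ) : Site 2)) (hi + ((j : ℕ) : Site 2)) M (ufatRadius X hT V₀ M) x ⊆ S :=
    fun x hx => (kitFace_subset_kitCube (X := X) hwide hx).trans (kitCube_subset_shell (X := X) hwide hnF hx)
  refine ⟨kitSData X hΔ xe Rw lo hi j M (ufatRadius X hT V₀ M) k, S, shyp_kit (X := X) hΔ hwide hnF k o Sfin, hN, hk, hSX, hSD,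
    fun x hx e he => ?_, fun x hx => hface x hx, fun x hx => ?_⟩
  · -- seeds avoid the pairs inside the shell
    rw [kitSData_K] at hx
    exact kitSeed_notMem_wireSet (X := X) hwide hx (π' := ballFin X xe Rw) (fun t ht => (Finset.mem_sdiff.1 ht).1) he
  · -- Step IV: edge contacts by the face-in-target shortcut, deep contacts by `kit_hIVQ`
    rw [kitSData_K] at hx
    rcases hcon x hx with ⟨u, hu, huT⟩ | ⟨γ, Qt, Ft, hγ, hFt, hQt, hfar, h3⟩
    · exact hIV_of_mem_face hδ hu huT (hSD (hface x hx hu))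
    · exact kit_hIVQ X hT V₀ hδ hmsel hstd hnF hwide hWD hSD hx γ hγ hFt hQt hfar h3

end BoxProdZ2

end Transplant

end Summit.CriticalPhenomena.PercolationContinuityZ3.Theorems

end
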